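import Summits.RiemannHypothesis.RiemannHypothesis.Theorems.PfPersistenceBarrierExplicitDatum
import HarnessLib

/-!
# PF-persistence BARRIER, III: the datum of `ζ`, its twins, and the `lambdapert` dial

Framing (page 1 of every `pub-rhpf` file): **long-odds MECHANISM SEARCH — nothing here is a claim
about RH.**  Every RH-bearing proposition is an explicit HYPOTHESIS of a theorem or one side of a
proved `↔` with a tree theorem; the negativity of a control family is never asserted unless PROVED
(it enters as a hypothesis `… ∈ Neg`, documented as observatory DATA in
`run/shared/lean/pub/pub-rhpf/pub-rhpf-barrier-prover/PROOF-PLAN.md`).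

Contents (overview in `PfPersistenceBarrierWalls`): `zetaDatum` with
`zetaDatum.quadratic = weilQuadratic` and `zetaDatum.Positivity ↔ WeilPositivity ↔ RiemannHypothesis`
(tree `weil_criterion_holds`); the PLANTED twin `plantedDatum w y` (invisible below `|y|`) and the
PRIME-DELETED twin `primedelDatum p` (invisible below `log p`) with the Weil instances of W1; the
`lambdapert` DIAL `lambdapertDatum δ` (`Q_δ(g) = Q(g) − δ·P(g ⋆ g̃)`, every window record continuous
in `δ`), with the Weil instances of W2 (`no_lambdapertStable_discriminator`,
`lambdapert_margin_nonpos`) and of W4 (`lambdapert_failure_windows_escape`).  Negativity of the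
dialled / twin data enters ONLY as hypotheses `… ∈ Neg` here (observatory DATA); part IV proves it
for heavy planted masses.
-/

set_option linter.dupNamespace false

noncomputable section

open MeasureTheory Set Filter Complex
open scoped Real Topology ComplexConjugate ContDiff

namespace Summit.RiemannHypothesis.RiemannHypothesis.Theorems.PfPersistenceBarrier

open Literature.NumberTheory.LFunctions

open ExplicitDatum

/-! ### The datum of `ζ`; planted and prime-deleted twins -/

/-- The explicit-formula datum of `ζ`: smooth part `ĝ(0) + ĝ(1) + W_∞(g)`, masses `Λ(n)/√n` at
`± log n` (Bombieri 2000 Thm 2 in the tree normalisation `weilFunctional`). [cite: Bombieri2000Weil, Thm 2 (p. 193)] -/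
def zetaDatum : ExplicitDatum where
  smooth k := weilPolarTerm k + weilArchTerm k
  pos n := Real.log n
  wt n := ((ArithmeticFunction.vonMangoldt n : ℝ) : ℂ) / (Real.sqrt n : ℂ)

/-- The prime term of `ζ`'s datum is the tree's `weilPrimeTerm` (definitionally). [folklore] -/
theorem zetaDatum_primeTerm (k : ℝ → ℂ) : zetaDatum.primeTerm k = weilPrimeTerm k := rfl

/-- `W_ζ = weilFunctional`. [folklore] -/
theorem zetaDatum_functional (k : ℝ → ℂ) : zetaDatum.functional k = weilFunctional k := by
  unfold ExplicitDatum.functional weilFunctional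
  rw [zetaDatum_primeTerm]
  simp only [zetaDatum]
  ring

/-- `Q_ζ = weilQuadratic`. [folklore] -/
theorem zetaDatum_quadratic (g : ℝ → ℂ) : zetaDatum.quadratic g = weilQuadratic g :=
  zetaDatum_functional _

/-- `zetaDatum.quadratic = weilQuadratic` as functions. [folklore] -/
theorem zetaDatum_quadratic_eq : zetaDatum.quadratic = weilQuadratic :=
  funext zetaDatum_quadratic

/-- `zetaDatum.Positivity ↔ WeilPositivity`. [folklore] -/
theorem zetaDatum_positivity_iff : zetaDatum.Positivity ↔ WeilPositivity := by
  simp only [ExplicitDatum.Positivity, WeilPositivity, zetaDatum_quadratic]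

/-- `zetaDatum.PositivityOn A ↔ WeilPositivityOn A`. [folklore] -/
theorem zetaDatum_positivityOn_iff (A : ℝ) : zetaDatum.PositivityOn A ↔ WeilPositivityOn A := by
  simp only [ExplicitDatum.PositivityOn, WeilPositivityOn, zetaDatum_quadratic]

/-- **`Q_ζ ≥ 0` at all windows is RH** (tree: `weil_criterion_holds`; Bombieri 2000 Thm 2). [cite: Bombieri2000Weil, Thm 2 (p. 193)] -/
theorem zetaDatum_positivity_iff_riemannHypothesis : zetaDatum.Positivity ↔ RiemannHypothesis := by
  rw [zetaDatum_positivity_iff]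
  exact weil_criterion_holds.symm

/-- `ζ` has no mass at index `0` (`Λ(0) = 0`). [folklore] -/
theorem zetaDatum_wt_zero : zetaDatum.wt 0 = 0 := by
  simp [zetaDatum]

/-- The PLANTED datum: `ζ` plus one extra point mass of weight `w` at `± y` (observatory family
`planted`, `pub-weilobs/CONTROLS.md` §2 (D); slot `0` is free since `Λ(0) = 0`). [folklore] -/
def plantedDatum (w : ℂ) (y : ℝ) : ExplicitDatum where
  smooth := zetaDatum.smooth
  pos n := if n = 0 then y else zetaDatum.pos n
  wt n := if n = 0 then w else zetaDatum.wt n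

/-- **A planted mass at `|y| > 2A` is invisible up to `A`**: `plantedDatum w y` is a twin of `ζ`
below `2A`, whatever the weight `w`. [folklore] -/
theorem zetaDatum_agreeBelow_plantedDatum (w : ℂ) {y B : ℝ} (hy : B < |y|) :
    AgreeBelow zetaDatum (plantedDatum w y) B := by
  intro i
  by_cases hi : i = 0
  · subst hi
    exact Or.inl ⟨Or.inl zetaDatum_wt_zero, Or.inr (by simpa [plantedDatum] using hy)⟩
  · exact Or.inr ⟨by simp [plantedDatum, hi], by simp [plantedDatum, hi]⟩

/-- Hence planted data have `ζ`'s windows below `|y|/2`: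
`Q_planted(g) = Q_ζ(g)` for `supp g ⊆ [-a, a]`, `2a < |y|`. [folklore] -/
theorem plantedDatum_quadratic_eq (w : ℂ) {y a : ℝ} (hy : 2 * a < |y|) {g : ℝ → ℂ}
    (hg : tsupport g ⊆ Icc (-a) a) : (plantedDatum w y).quadratic g = weilQuadratic g := by
  rw [← zetaDatum_quadratic]
  exact (quadratic_eq_of_agreeBelow (zetaDatum_agreeBelow_plantedDatum w hy) rfl le_rfl hg).symm

/-- **W1 against a planted twin.** If `Neg` contains a planted datum with `|y| > 2A` (declared
negative family; its negativity at SOME window is observatory DATA and enters only through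
`hNeg`), no predicate window-local up to `A` discriminates `ζ` from `Neg`. [folklore] -/
theorem no_windowLocal_discriminator_planted {P : ExplicitDatum → Prop} {A : ℝ}
    {Neg : Set ExplicitDatum} (hP : IsWindowLocal P A) {w : ℂ} {y : ℝ}
    (hNeg : plantedDatum w y ∈ Neg) (hy : 2 * A < |y|) : ¬ Discriminates P zetaDatum Neg :=
  no_windowLocal_discriminator hP hNeg (zetaDatum_agreeBelow_plantedDatum w hy) rfl

/-- The PRIME-DELETED datum: `ζ` with every mass at a multiple of `p` removed (observatory family
`primedel(p)`: the Euler factor at `p` deleted; masses at non-prime-powers are `0` anyway). [folklore] -/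
def primedelDatum (p : ℕ) : ExplicitDatum where
  smooth := zetaDatum.smooth
  pos := zetaDatum.pos
  wt n := if p ∣ n then 0 else zetaDatum.wt n

/-- **Deleting the prime `p` is invisible below `log p`**: `primedelDatum p` is a twin of `ζ`
below any `B < log p`. [folklore] -/
theorem zetaDatum_agreeBelow_primedelDatum {p : ℕ} {B : ℝ} (hB : B < Real.log p) :
    AgreeBelow zetaDatum (primedelDatum p) B := by
  intro n
  by_cases hpn : p ∣ n
  · by_cases hn : n = 0
    · subst hn
      exact Or.inl ⟨Or.inl zetaDatum_wt_zero, Or.inl (by simp [primedelDatum])⟩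
    · have hp : p ≠ 0 := fun hp ↦ hn (Nat.eq_zero_of_zero_dvd (hp ▸ hpn))
      have hp0 : (0 : ℝ) < p := by exact_mod_cast Nat.pos_of_ne_zero hp
      have hle : (p : ℝ) ≤ n := by exact_mod_cast Nat.le_of_dvd (Nat.pos_of_ne_zero hn) hpn
      have hlog : B < |zetaDatum.pos n| := by
        have h1 : Real.log p ≤ Real.log n := Real.log_le_log hp0 hle
        have h2 : 0 ≤ Real.log (n : ℝ) :=
          Real.log_nonneg (Nat.one_le_cast.mpr (Nat.pos_of_ne_zero hn))
        show B < |Real.log (n : ℝ)|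
        rw [abs_of_nonneg h2]
        exact hB.trans_le h1
      exact Or.inl ⟨Or.inr hlog, Or.inl (by simp [primedelDatum, hpn])⟩
  · exact Or.inr ⟨rfl, by simp [primedelDatum, hpn]⟩

/-- **W1 against a prime-deleted twin**: with `primedelDatum p ∈ Neg` and `2A < log p`, no
predicate window-local up to `A` discriminates `ζ` from `Neg`. [folklore] -/
theorem no_windowLocal_discriminator_primedel {P : ExplicitDatum → Prop} {A : ℝ}
    {Neg : Set ExplicitDatum} (hP : IsWindowLocal P A) {p : ℕ} (hNeg : primedelDatum p ∈ Neg)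
    (hp : 2 * A < Real.log p) : ¬ Discriminates P zetaDatum Neg :=
  no_windowLocal_discriminator hP hNeg (zetaDatum_agreeBelow_primedelDatum hp) rfl

/-! ### The `lambdapert` dial and the Weil instance of W2 -/

/-- The LAMBDAPERT dial: weights `(1 + δ) Λ(n)/√n` (observatory family `lambdapert`, uniform
kind; `CONTROLS.md` §2 (B)); `δ = 0` is `ζ`. [folklore] -/
def lambdapertDatum (δ : ℝ) : ExplicitDatum where
  smooth := zetaDatum.smooth
  pos := zetaDatum.pos
  wt n := (1 + (δ : ℂ)) * zetaDatum.wt n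

/-- The dial's prime term is `(1 + δ)` times that of `ζ` (no summability needed: `tsum_mul_left`). [folklore] -/
theorem lambdapertDatum_primeTerm (δ : ℝ) (k : ℝ → ℂ) :
    (lambdapertDatum δ).primeTerm k = (1 + (δ : ℂ)) * weilPrimeTerm k := by
  rw [← zetaDatum_primeTerm]
  unfold ExplicitDatum.primeTerm
  rw [← tsum_mul_left]
  refine tsum_congr fun n ↦ ?_
  simp only [lambdapertDatum]
  ring

/-- **The dial is affine in `δ`**: `W_δ(k) = W(k) − δ · P(k)`. [folklore] -/
theorem lambdapertDatum_functional (δ : ℝ) (k : ℝ → ℂ) :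
    (lambdapertDatum δ).functional k = weilFunctional k - (δ : ℂ) * weilPrimeTerm k := by
  rw [← zetaDatum_functional]
  unfold ExplicitDatum.functional
  rw [lambdapertDatum_primeTerm, zetaDatum_primeTerm]
  simp only [lambdapertDatum]
  ring

/-- `Q_δ(g) = Q(g) − δ · P(g ⋆ g̃)`. [folklore] -/
theorem lambdapertDatum_quadratic (δ : ℝ) (g : ℝ → ℂ) :
    (lambdapertDatum δ).quadratic g =
      weilQuadratic g - (δ : ℂ) * weilPrimeTerm (weilConv g (weilReflect g)) :=
  lambdapertDatum_functional δ _

/-- **The dial converges to `ζ` window by window**: `Q_δ(g) → Q(g)` as `δ → 0`, for every `g`. [folklore] -/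
theorem tendsto_lambdapertDatum_quadratic (g : ℝ → ℂ) :
    Tendsto (fun δ : ℝ ↦ (lambdapertDatum δ).quadratic g) (𝓝 0) (𝓝 (zetaDatum.quadratic g)) := by
  simp only [lambdapertDatum_quadratic, zetaDatum_quadratic]
  have h : Continuous fun δ : ℝ ↦
      weilQuadratic g - (δ : ℂ) * weilPrimeTerm (weilConv g (weilReflect g)) :=
    continuous_const.sub (Complex.continuous_ofReal.mul continuous_const)
  simpa using h.tendsto 0

/-- The window records of the dial converge to those of `ζ`, coordinate by coordinate. [folklore] -/
theorem tendsto_lambdapertDatum_window (a : ℝ) (g : ℝ → ℂ) :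
    Tendsto (fun δ : ℝ ↦ (lambdapertDatum δ).window a g) (𝓝 0) (𝓝 (zetaDatum.window a g)) := by
  unfold ExplicitDatum.window
  split_ifs with hg
  · exact tendsto_lambdapertDatum_quadratic g
  · exact tendsto_const_nhds

/-- … hence in the product topology of records `ℝ → ((ℝ → ℂ) → ℂ)`. [folklore] -/
theorem tendsto_lambdapertDatum_record :
    Tendsto (fun δ : ℝ ↦ (lambdapertDatum δ).window) (𝓝 0) (𝓝 zetaDatum.window) :=
  tendsto_pi_nhds.2 fun a ↦ tendsto_pi_nhds.2 fun g ↦ tendsto_lambdapertDatum_window a g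

/-- The real parts converge too. [folklore] -/
theorem tendsto_lambdapertDatum_quadratic_re (g : ℝ → ℂ) :
    Tendsto (fun δ : ℝ ↦ ((lambdapertDatum δ).quadratic g).re) (𝓝 0)
      (𝓝 (zetaDatum.quadratic g).re) :=
  (Complex.continuous_re.tendsto _).comp (tendsto_lambdapertDatum_quadratic g)

/-- Per-direction STABILITY along the dial: a strict inequality `Re Q_ζ(g) > 0` persists for small
`δ` (so strict single-direction margins are stable — and therefore, by W2, cannot discriminate
against a negative class containing the dial). [folklore] -/
theorem lambdapert_eventually_pos {g : ℝ → ℂ} (hg : 0 < (zetaDatum.quadratic g).re) :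
    ∀ᶠ δ : ℝ in 𝓝 0, 0 < ((lambdapertDatum δ).quadratic g).re :=
  (tendsto_lambdapertDatum_quadratic_re g).eventually (eventually_gt_nhds hg)

/-- **W2, Weil instance (stability form).** If along some proper filter of dial parameters the
`lambdapert` data are in `Neg` (observatory DATA: `lambdapert(δ)` is Arb-certified negative for
every gridded `δ ≠ 0`; here a HYPOTHESIS) and `P` holds along the dial ("stable under the
perturbation family"), then `P` does not discriminate `ζ` from `Neg`. [folklore] -/
theorem no_lambdapertStable_discriminator {P : ExplicitDatum → Prop} {Neg : Set ExplicitDatum}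
    {l : Filter ℝ} [l.NeBot] (hNeg : ∀ᶠ δ in l, lambdapertDatum δ ∈ Neg)
    (hstab : ∀ᶠ δ in l, P (lambdapertDatum δ)) : ¬ Discriminates P zetaDatum Neg :=
  no_eventually_discriminator hNeg hstab

/-- **W2, Weil instance (zero margin).** A real margin `f` on data, continuous at `ζ` along the
dial within a filter `l ≤ 𝓝 0` carrying negatives, and `≤ 0` on `Neg`, is `≤ 0` at `ζ`. [folklore] -/
theorem lambdapert_margin_nonpos {f : ExplicitDatum → ℝ} {Neg : Set ExplicitDatum} {l : Filter ℝ}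
    [l.NeBot] (hf : Tendsto (fun δ ↦ f (lambdapertDatum δ)) l (𝓝 (f zetaDatum)))
    (hNeg : ∀ᶠ δ in l, lambdapertDatum δ ∈ Neg) (hfNeg : ∀ F ∈ Neg, f F ≤ 0) : f zetaDatum ≤ 0 :=
  margin_nonpos_of_tendsto (c := lambdapertDatum) hf hNeg hfNeg

/-- **W2 for single-direction margins.** For a fixed test `g`, the margin `F ↦ Re Q_F(g)` is
continuous along the dial (proved above); so if the dial carries negatives near `δ = 0` on which
`Re Q(g) ≤ 0`, then `Re Q_ζ(g) ≤ 0` — a strict single-direction inequality never discriminates. [folklore] -/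
theorem lambdapert_direction_margin_nonpos {g : ℝ → ℂ} {Neg : Set ExplicitDatum} {l : Filter ℝ}
    [l.NeBot] (hl : l ≤ 𝓝 0) (hNeg : ∀ᶠ δ in l, lambdapertDatum δ ∈ Neg)
    (hfNeg : ∀ F ∈ Neg, (F.quadratic g).re ≤ 0) : (zetaDatum.quadratic g).re ≤ 0 :=
  lambdapert_margin_nonpos (f := fun F ↦ (F.quadratic g).re)
    ((tendsto_lambdapertDatum_quadratic_re g).mono_left hl) hNeg hfNeg

/-! ### W4, Weil instance -/

/-- **W4 along the dial.** An all-windows discriminator `F ↦ ∀ a, Pw a F` that is per-window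
stable along a filter of dial parameters carrying negatives has, for every finite window set `S`,
dialled negatives failing OUTSIDE `S` (the failure windows escape; DATA: the flip windows of the
single-term dials go to `∞` as the dial closes, `GAP-CLASSES.md` PF-N2). [folklore] -/
theorem lambdapert_failure_windows_escape {Pw : ℝ → ExplicitDatum → Prop}
    {Neg : Set ExplicitDatum} {l : Filter ℝ} [l.NeBot]
    (h : Discriminates (fun F ↦ ∀ a, Pw a F) zetaDatum Neg)
    (hNeg : ∀ᶠ δ in l, lambdapertDatum δ ∈ Neg) (hstab : ∀ a, ∀ᶠ δ in l, Pw a (lambdapertDatum δ))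
    (S : Finset ℝ) : ∃ᶠ δ in l, ∃ a ∉ S, ¬ Pw a (lambdapertDatum δ) :=
  h.frequently_failure_outside hNeg hstab S

end Summit.RiemannHypothesis.RiemannHypothesis.Theorems.PfPersistenceBarrier

end
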